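import Summits.QuantumFields.BalabanUV.T4Continuum.Spine.NE1p.B7AveragingComplexRaySize
import Mathlib.Analysis.Complex.Liouville

/-!
# T⁴ programme, spine estimate NE1′ (node O3b/H2) — door (c), route (ii): a UNIFORM BOUND on the quadratic term of the
# covariant logarithm of (42) at every SMALL CURVED BACKGROUND `e^{B}`, by Cauchy's estimate on a complex disc

Cell `pub-balaban-gaps` (YM blitz Y1, track G2), seat `ne1` gen 10 (prover-pub-balaban-gaps-ne1-g10-0); record `HOME/ne/NE1.md` v10.x
R61 ∕ `HOME/pub-balaban-gaps-ne1/gen10/R61-PLAN.md` step (ii-d), `t`-part.  ADDITIVE — imports this seat's `B7AveragingComplexRaySize`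
(gen 10: the complex-ray size bounds) and Mathlib's `Analysis.Complex.Liouville` (Cauchy's estimate); the lineages' `B7Prop1Explicit`
∕ `B7Prop3Flat` (`val_bavg`) ∕ `MatrixLog` BY NAME; 0 def.

WHAT THIS FILE PROVES ([folklore] bookkeeping + one use of Cauchy's estimate; 0 sorry).  For bond fields `A, B` with `‖A(b)‖ ≤ a`,
`‖B(b)‖ ≤ b`, complex `s, t`, `ℓ := 2dL + 2L`, `L ≥ 1`, and the covariant ratio `R(s,t) := Ū_c(e^{tA}e^{sB})·Ū_c(e^{sB})⁻¹`:
* §1 SIZES: `norm_bavg_ray_sub_one_le` ∕ `norm_bavg_ray_inv_sub_one_le` — `‖Ū_c(e^{tA}e^{sB})^{±1} − 1‖ ≤ e^{2(e^{ℓc} − 1) + ℓc} − 1`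
  for `ℓc ≤ 1∕5`, `c = ‖t‖a + ‖s‖b`; **`norm_ray_ratio_sub_one_le_half` — `‖R(s,t) − 1‖ ≤ 1∕2` once `ℓ(‖t‖a + ‖s‖b) ≤ 1∕20`**
  (so `‖log R‖ ≤ 1`, (21)).
* §2 HOLOMORPHY IN `t`: letters, words, loops of `e^{tA}e^{sB}` are ENTIRE in `t` (`differentiable_hol_ray`); `X_c`, `Ū_c` and `log R(s,·)`
  are complex-differentiable at every `t` of the closed disc `ℓ(‖t‖a + ‖s‖b) ≤ 1∕20` (`differentiableAt_mlog_ray_ratio`).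
* §3 **`norm_iteratedDeriv_two_mlog_ray_ratio_le` — CAUCHY: if `ρ > 0` and `ℓ(ρa + ‖s‖b) ≤ 1∕20` then
  `‖d²/dt²|₀ log R(s,t)‖ ≤ 2∕ρ²`** (Mathlib `Complex.norm_iteratedDeriv_le_of_forall_mem_sphere_norm_le` with `n = 2`, `C = 1`), and
  **`norm_iteratedDeriv_two_mlog_background_ratio_le` — at EVERY background `e^{B}` with `ℓ·b ≤ 1∕40` and every `A` with `0 < a`:
  `‖d²/dt²|₀ log( Ū_c(e^{tA}e^{B}) · Ū_c(e^{B})⁻¹ )‖ ≤ 3200·ℓ²·a²`** — the quadratic term of the covariant block-average logarithm is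
  SECOND ORDER IN THE SLOT with a constant UNIFORM over all small (curved) backgrounds.  This is the `M = C·a²` of R61-PLAN (ii-d);
  the remaining step to «∝ non-flatness» is the Lipschitz bound in `s` ((ii-c) + Cauchy in `s`).
What it does NOT do: analyticity in the background parameter `s`, the statement (∗) `‖K(1) − K(0)‖ ≤ C·a²·b` of R61-PLAN, RG densities.

HONEST FRAMING.  [folklore]; nothing of Bałaban's asserted; NE1′ NOT proved; R61 NOT proved (in progress); spine 0∕9; (B) 0∕13; binders 0∕6;
one fixed finite T⁴ — NOT ℝ⁴, NOT infinite volume, NOT a mass gap, NOT Clay.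
-/

noncomputable section

open scoped Topology
open NormedSpace Filter Metric

namespace Summit.QuantumFields.BalabanUV.T4Continuum.NE1p.B7AveragingCommutator

open Literature.MathematicalPhysics.QuantumFieldTheory.Balaban1983to89.MatrixLog (mlog analyticAt_mlog norm_mlog_le_two_mul)
open Literature.MathematicalPhysics.QuantumFieldTheory.Balaban1983to89.B7Prop1Explicit
open Literature.MathematicalPhysics.QuantumFieldTheory.Balaban1983to89.B7Prop3Flat (expCfg val_bavg)
open Literature.MathematicalPhysics.QuantumFieldTheory.Balaban1983to89.B7Prop3GeneralRotated (expCfg_zero)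

variable {𝔸 : Type*} [NormedRing 𝔸] [NormedAlgebra ℂ 𝔸] [CompleteSpace 𝔸]

/-! ## §0 A numerical fact -/

/-- The exponent bookkeeping of §1: if `0 ≤ x ≤ 1∕20` then `exp(2·(2(eˣ − 1) + x)) − 1 ≤ 1∕2`. [folklore] -/
theorem exp_budget_le_half {x : ℝ} (h0 : 0 ≤ x) (h1 : x ≤ 1 / 20) :
    Real.exp (2 * (2 * (Real.exp x - 1) + x)) - 1 ≤ 1 / 2 := by
  -- `eʸ − 1 ≤ y + y²` for `0 ≤ y ≤ 1` (Mathlib `Real.abs_exp_sub_one_sub_id_le`; the tree's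
  -- `Literature.Computability.QuantumComplexity.exp_sub_one_le_add_sq` is the same fact — inlined here to keep the imports topical)
  have hsq : ∀ y : ℝ, 0 ≤ y → y ≤ 1 → Real.exp y - 1 ≤ y + y ^ 2 := fun y hy0 hy1 => by
    have h := Real.abs_exp_sub_one_sub_id_le (x := y) (by rw [abs_of_nonneg hy0]; exact hy1)
    have h' := (le_abs_self _).trans h
    linarith
  have hx := hsq x h0 (by linarith)
  have hP0 : 0 ≤ 2 * (2 * (Real.exp x - 1) + x) := by
    have : 0 ≤ Real.exp x - 1 := by have := Real.add_one_le_exp x; linarith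
    positivity
  have hP1 : 2 * (2 * (Real.exp x - 1) + x) ≤ 31 / 100 := by nlinarith
  have h2 := hsq _ hP0 (by linarith)
  nlinarith [h2, hP1, hP0]

omit [NormedAlgebra ℂ 𝔸] [CompleteSpace 𝔸] in
/-- Monotonicity of the exponential size bound: `‖g − 1‖ ≤ eᵖ − 1 ≤ e^q − 1` for `p ≤ q`. [folklore] -/
theorem norm_sub_one_le_exp_mono {g : 𝔸} {p q : ℝ} (hg : ‖g - 1‖ ≤ Real.exp p - 1) (hpq : p ≤ q) :
    ‖g - 1‖ ≤ Real.exp q - 1 :=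
  hg.trans (by gcongr)

/-! ## §1 Sizes of `Ū_c(e^{tA}e^{sB})^{±1}` and of the covariant ratio -/

section Sizes

variable {d : ℕ} {A B : Site d → Fin d → 𝔸} {a b : ℝ}
  (ha : ∀ (y : Site d) (μ : Fin d), ‖A y μ‖ ≤ a) (hb : ∀ (y : Site d) (μ : Fin d), ‖B y μ‖ ≤ b) (hann : 0 ≤ a) (hbnn : 0 ≤ b)

include ha hb hann hbnn

/-- **`‖Ū_c(e^{tA}e^{sB}) − 1‖ ≤ exp(2(e^{ℓc} − 1) + ℓc) − 1`** (`ℓ = 2dL+2L`, `c = ‖t‖a + ‖s‖b`, `ℓc ≤ 1∕5`, `L ≥ 1`): `Ū = exp(X_c)·(Γ_c)`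
with `‖X_c‖ ≤ 2(e^{ℓc} − 1)` (file 14) and `‖(e^{tA}e^{sB})(Γ_c) − 1‖ ≤ e^{Lc} − 1 ≤ e^{ℓc} − 1`. [cite: Balaban1985Averaging, (42) p.23, (21) p.21] -/
theorem norm_bavg_ray_sub_one_le (L : ℕ) (hL : 1 ≤ L) (s t : ℂ)
    (h : (2 * d * L + 2 * L) * (‖t‖ * a + ‖s‖ * b) ≤ 1 / 5) (q : Site d) (κ : Fin d) :
    ‖((bavg L (expCfg (t • A) * expCfg (s • B)) q κ : 𝔸ˣ) : 𝔸) - 1‖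
      ≤ Real.exp (2 * (Real.exp ((2 * d * L + 2 * L) * (‖t‖ * a + ‖s‖ * b)) - 1)
          + (2 * d * L + 2 * L) * (‖t‖ * a + ‖s‖ * b)) - 1 := by
  rw [val_bavg]
  have hc : 0 ≤ ‖t‖ * a + ‖s‖ * b := by positivity
  have hX := norm_Xavg_ray_le ha hb hann hbnn L hL s t h q κ
  have hE : ‖exp (Xavg L (expCfg (t • A) * expCfg (s • B)) q κ) - 1‖
      ≤ Real.exp (2 * (Real.exp ((2 * d * L + 2 * L) * (‖t‖ * a + ‖s‖ * b)) - 1)) - 1 :=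
    (norm_exp_sub_one_le_of_norm_le hX).1
  have hS : ‖((hol (expCfg (t • A) * expCfg (s • B)) q (seg κ L) : 𝔸ˣ) : 𝔸) - 1‖
      ≤ Real.exp ((2 * d * L + 2 * L) * (‖t‖ * a + ‖s‖ * b)) - 1 := by
    refine norm_sub_one_le_exp_mono (norm_hol_ray_sub_one_le ha hb s t (seg κ L) q) ?_
    rw [length_seg, Int.natAbs_natCast]
    have hL' : (L : ℝ) ≤ 2 * d * L + 2 * L := by
      have : (0 : ℝ) ≤ d * L := by positivity
      linarith
    exact mul_le_mul_of_nonneg_right hL' hc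
  exact norm_mul_sub_one_le_exp hE hS

/-- The inverse: **`‖Ū_c(e^{tA}e^{sB})⁻¹ − 1‖ ≤ exp(2(e^{ℓc} − 1) + ℓc) − 1`** (`Ū⁻¹ = (Γ_c)⁻¹·exp(−X_c)`, the reversed straight word and
`‖e^{−X} − 1‖ ≤ e^{‖X‖} − 1`). [cite: Balaban1985Averaging, (42) p.23, (21) p.21] -/
theorem norm_bavg_ray_inv_sub_one_le (L : ℕ) (hL : 1 ≤ L) (s t : ℂ)
    (h : (2 * d * L + 2 * L) * (‖t‖ * a + ‖s‖ * b) ≤ 1 / 5) (q : Site d) (κ : Fin d) :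
    ‖(((bavg L (expCfg (t • A) * expCfg (s • B)) q κ)⁻¹ : 𝔸ˣ) : 𝔸) - 1‖
      ≤ Real.exp ((2 * d * L + 2 * L) * (‖t‖ * a + ‖s‖ * b)
          + 2 * (Real.exp ((2 * d * L + 2 * L) * (‖t‖ * a + ‖s‖ * b)) - 1)) - 1 := by
  have hc : 0 ≤ ‖t‖ * a + ‖s‖ * b := by positivity
  have e1 : (((bavg L (expCfg (t • A) * expCfg (s • B)) q κ)⁻¹ : 𝔸ˣ) : 𝔸)
      = ((hol (expCfg (t • A) * expCfg (s • B)) (q + disp (seg κ (L : ℤ))) (revWord (seg κ L)) : 𝔸ˣ) : 𝔸)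
        * exp (-Xavg L (expCfg (t • A) * expCfg (s • B)) q κ) := by
    rw [hol_revWord' _ (q + disp (seg κ (L : ℤ))) (seg κ L) rfl]
    show ((((expUnit (Xavg L (expCfg (t • A) * expCfg (s • B)) q κ)
        * hol (expCfg (t • A) * expCfg (s • B)) q (seg κ L))⁻¹ : 𝔸ˣ)) : 𝔸) = _
    rw [mul_inv_rev, Units.val_mul, val_inv_expUnit, val_expUnit]
  rw [e1]
  have hX := norm_Xavg_ray_le ha hb hann hbnn L hL s t h q κ
  have hE : ‖exp (-Xavg L (expCfg (t • A) * expCfg (s • B)) q κ) - 1‖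
      ≤ Real.exp (2 * (Real.exp ((2 * d * L + 2 * L) * (‖t‖ * a + ‖s‖ * b)) - 1)) - 1 :=
    (norm_exp_sub_one_le_of_norm_le (by rw [norm_neg]; exact hX)).1
  have hS : ‖((hol (expCfg (t • A) * expCfg (s • B)) (q + disp (seg κ (L : ℤ))) (revWord (seg κ L)) : 𝔸ˣ) : 𝔸) - 1‖
      ≤ Real.exp ((2 * d * L + 2 * L) * (‖t‖ * a + ‖s‖ * b)) - 1 := by
    refine norm_sub_one_le_exp_mono (norm_hol_ray_sub_one_le ha hb s t _ _) ?_
    rw [length_revWord, length_seg, Int.natAbs_natCast]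
    have hL' : (L : ℝ) ≤ 2 * d * L + 2 * L := by
      have : (0 : ℝ) ≤ d * L := by positivity
      linarith
    exact mul_le_mul_of_nonneg_right hL' hc
  exact norm_mul_sub_one_le_exp hS hE

/-- **THE COVARIANT RATIO STAYS WITHIN `1∕2` OF `1`**: if `ℓ(‖t‖a + ‖s‖b) ≤ 1∕20` then
`‖Ū_c(e^{tA}e^{sB})·Ū_c(e^{sB})⁻¹ − 1‖ ≤ 1∕2` — inside the radius of (21) with room, uniformly on the polydisc (the background factor
is the case `t = 0`). [cite: Balaban1985Averaging, (21) p.21, (42) p.23] -/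
theorem norm_ray_ratio_sub_one_le_half (L : ℕ) (hL : 1 ≤ L) (s t : ℂ)
    (h : (2 * d * L + 2 * L) * (‖t‖ * a + ‖s‖ * b) ≤ 1 / 20) (q : Site d) (κ : Fin d) :
    ‖((bavg L (expCfg (t • A) * expCfg (s • B)) q κ * (bavg L (expCfg (s • B)) q κ)⁻¹ : 𝔸ˣ) : 𝔸) - 1‖ ≤ 1 / 2 := by
  set x : ℝ := (2 * d * L + 2 * L) * (‖t‖ * a + ‖s‖ * b) with hx
  have hx0 : 0 ≤ x := by positivity
  have hta : 0 ≤ (2 * d * L + 2 * L) * (‖t‖ * a) := by positivity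
  -- the background factor is the ray at `t = 0`
  have h0 : (2 * d * L + 2 * L) * (‖(0 : ℂ)‖ * a + ‖s‖ * b) ≤ 1 / 5 := by
    rw [norm_zero, zero_mul, zero_add]; nlinarith
  have hB := norm_bavg_ray_inv_sub_one_le ha hb hann hbnn L hL s 0 h0 q κ
  rw [zero_smul, expCfg_zero, one_mul, norm_zero, zero_mul, zero_add] at hB
  have hU := norm_bavg_ray_sub_one_le ha hb hann hbnn L hL s t (by linarith) q κ
  rw [Units.val_mul]
  refine (norm_mul_sub_one_le_exp hU hB).trans ?_
  -- monotonicity: the `s`-only exponent is below the `(s,t)` one, and the total is `≤ 2·(2(eˣ − 1) + x)`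
  have hmono : (2 * d * L + 2 * L) * (‖s‖ * b) ≤ x := by rw [hx]; nlinarith
  have hexp_mono : Real.exp ((2 * d * L + 2 * L) * (‖s‖ * b)) ≤ Real.exp x := Real.exp_le_exp.2 hmono
  calc _ ≤ Real.exp (2 * (2 * (Real.exp x - 1) + x)) - 1 := by gcongr; linarith
    _ ≤ 1 / 2 := exp_budget_le_half hx0 h

end Sizes

/-! ## §2 Holomorphy in `t` -/

section Holo

variable {d : ℕ} (A B : Site d → Fin d → 𝔸) (s : ℂ)

/-- Every letter of `e^{tA}e^{sB}` is an entire function of `t` (products of exponentials of `t`-multiples). [folklore] -/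
theorem differentiable_stepHol_ray (x : Site d) (l : Letter d) :
    Differentiable ℂ (fun t : ℂ => ((stepHol (expCfg (t • A) * expCfg (s • B)) x l : 𝔸ˣ) : 𝔸)) := by
  have hexp : ∀ (X : 𝔸), Differentiable ℂ (fun t : ℂ => exp (t • X)) := fun X t =>
    (hasDerivAt_exp_smul_const' X t).differentiableAt
  obtain ⟨μ, c⟩ := l
  cases c
  · have e1 : (fun t : ℂ => ((stepHol (expCfg (t • A) * expCfg (s • B)) x (μ, false) : 𝔸ˣ) : 𝔸))
        = fun t : ℂ => exp (-(s • B (x - e μ) μ)) * exp (-(t • A (x - e μ) μ)) := by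
      funext t
      rw [stepHol_false]
      have e2 : ((expCfg (t • A) * expCfg (s • B)) (x - e μ) μ)⁻¹
          = (expUnit ((s • B) (x - e μ) μ))⁻¹ * (expUnit ((t • A) (x - e μ) μ))⁻¹ := by
        rw [Pi.mul_apply, Pi.mul_apply, mul_inv_rev]; rfl
      rw [e2, Units.val_mul, val_inv_expUnit, val_inv_expUnit, val_expUnit, val_expUnit]; rfl
    rw [e1]
    simp_rw [← smul_neg]
    exact (differentiable_const _).mul (hexp _)
  · have e1 : (fun t : ℂ => ((stepHol (expCfg (t • A) * expCfg (s • B)) x (μ, true) : 𝔸ˣ) : 𝔸))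
        = fun t : ℂ => exp (t • A x μ) * exp (s • B x μ) := by
      funext t
      rw [stepHol_true]
      have e2 : (expCfg (t • A) * expCfg (s • B)) x μ = expUnit ((t • A) x μ) * expUnit ((s • B) x μ) := by
        rw [Pi.mul_apply, Pi.mul_apply]; rfl
      rw [e2, Units.val_mul, val_expUnit, val_expUnit]; rfl
    rw [e1]
    exact (hexp _).mul (differentiable_const _)

/-- Word transports of `e^{tA}e^{sB}` are entire in `t`. [cite: Balaban1985Averaging, (9) p.18] -/
theorem differentiable_hol_ray :
    ∀ (w : List (Letter d)) (x : Site d),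
      Differentiable ℂ (fun t : ℂ => ((hol (expCfg (t • A) * expCfg (s • B)) x w : 𝔸ˣ) : 𝔸))
  | [], x => by simp
  | l :: w, x => by
    have e1 : (fun t : ℂ => ((hol (expCfg (t • A) * expCfg (s • B)) x (l :: w) : 𝔸ˣ) : 𝔸))
        = fun t : ℂ => ((stepHol (expCfg (t • A) * expCfg (s • B)) x l : 𝔸ˣ) : 𝔸)
            * ((hol (expCfg (t • A) * expCfg (s • B)) (x + l.vec) w : 𝔸ˣ) : 𝔸) := by
      funext t; rw [hol_cons, Units.val_mul]
    rw [e1]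
    exact (differentiable_stepHol_ray A B s x l).mul (differentiable_hol_ray w (x + l.vec))

variable {A B} {a b : ℝ} (ha : ∀ (y : Site d) (μ : Fin d), ‖A y μ‖ ≤ a) (hb : ∀ (y : Site d) (μ : Fin d), ‖B y μ‖ ≤ b)
  (hann : 0 ≤ a) (hbnn : 0 ≤ b)

include ha hb hann hbnn

/-- The averaged bond `Ū_c(e^{tA}e^{sB})` is complex-differentiable at every `t` of the polydisc `ℓ(‖t‖a + ‖s‖b) ≤ 1∕5` (the loops
stay inside the radius of (21), where `log` is analytic; `exp` is entire). [cite: Balaban1985Averaging, (21) p.21, (42) p.23] -/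
theorem differentiableAt_bavg_ray (L : ℕ) (t : ℂ) (h : (2 * d * L + 2 * L) * (‖t‖ * a + ‖s‖ * b) ≤ 1 / 5)
    (q : Site d) (κ : Fin d) :
    DifferentiableAt ℂ (fun u : ℂ => ((bavg L (expCfg (u • A) * expCfg (s • B)) q κ : 𝔸ˣ) : 𝔸)) t := by
  simp_rw [val_bavg]
  refine DifferentiableAt.mul ?_ ((differentiable_hol_ray A B s (seg κ L) q) t)
  refine ((NormedSpace.exp_analytic (𝕂 := ℂ) _).differentiableAt).comp t ?_
  unfold Xavg
  refine DifferentiableAt.fun_sum fun r _ => DifferentiableAt.const_smul ?_ _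
  have hW : DifferentiableAt ℂ
      (fun u : ℂ => ((Wcx L (expCfg (u • A) * expCfg (s • B)) q κ (boxVec L r) : 𝔸ˣ) : 𝔸)) t := by
    simp_rw [Wcx_eq_hol_loop]; exact (differentiable_hol_ray A B s _ q) t
  have hm : DifferentiableAt ℂ (mlog : 𝔸 → 𝔸) ((Wcx L (expCfg (t • A) * expCfg (s • B)) q κ (boxVec L r) : 𝔸ˣ) : 𝔸) :=
    (analyticAt_mlog ((norm_Wcx_ray_sub_one_lt ha hb hann hbnn L s t h q κ r).trans (by norm_num))).differentiableAt
  have hc := hm.comp t hW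
  simpa [Function.comp_def] using hc

/-- **`t ↦ log( Ū_c(e^{tA}e^{sB}) · Ū_c(e^{sB})⁻¹ )` is complex-differentiable at every `t` with `ℓ(‖t‖a + ‖s‖b) ≤ 1∕20`**
(the ratio is within `1∕2` of `1`, inside the radius of (21)). [cite: Balaban1985Averaging, (21) p.21, (42) p.23] -/
theorem differentiableAt_mlog_ray_ratio (L : ℕ) (hL : 1 ≤ L) (t : ℂ)
    (h : (2 * d * L + 2 * L) * (‖t‖ * a + ‖s‖ * b) ≤ 1 / 20) (q : Site d) (κ : Fin d) :
    DifferentiableAt ℂ (fun u : ℂ =>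
      mlog (((bavg L (expCfg (u • A) * expCfg (s • B)) q κ * (bavg L (expCfg (s • B)) q κ)⁻¹ : 𝔸ˣ) : 𝔸))) t := by
  have hR := norm_ray_ratio_sub_one_le_half ha hb hann hbnn L hL s t h q κ
  have hdiff : DifferentiableAt ℂ (fun u : ℂ =>
      (((bavg L (expCfg (u • A) * expCfg (s • B)) q κ * (bavg L (expCfg (s • B)) q κ)⁻¹ : 𝔸ˣ) : 𝔸))) t := by
    simp_rw [Units.val_mul]
    exact (differentiableAt_bavg_ray s ha hb hann hbnn L t (by linarith) q κ).mul_const _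
  have hm : DifferentiableAt ℂ (mlog : 𝔸 → 𝔸)
      (((bavg L (expCfg (t • A) * expCfg (s • B)) q κ * (bavg L (expCfg (s • B)) q κ)⁻¹ : 𝔸ˣ) : 𝔸)) :=
    (analyticAt_mlog (hR.trans_lt (by norm_num))).differentiableAt
  have hc := hm.comp t hdiff
  simpa [Function.comp_def] using hc

end Holo

/-! ## §3 Cauchy's estimate in `t` -/

section Cauchy

variable {d : ℕ} {A B : Site d → Fin d → 𝔸} {a b : ℝ}
  (ha : ∀ (y : Site d) (μ : Fin d), ‖A y μ‖ ≤ a) (hb : ∀ (y : Site d) (μ : Fin d), ‖B y μ‖ ≤ b) (hann : 0 ≤ a) (hbnn : 0 ≤ b)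

include ha hb hann hbnn

/-- **CAUCHY'S ESTIMATE FOR THE QUADRATIC TERM AT A CURVED BACKGROUND**: if `ρ > 0` and `ℓ(ρa + ‖s‖b) ≤ 1∕20` (`ℓ = 2dL+2L`, `L ≥ 1`)
then `‖d²/dt²|₀ log( Ū_c(e^{tA}e^{sB}) · Ū_c(e^{sB})⁻¹ )‖ ≤ 2∕ρ²`: the function is holomorphic on the closed disc of radius `ρ` and
bounded by `1` there (`‖log R‖ ≤ 2‖R − 1‖ ≤ 1`), so Mathlib's `Complex.norm_iteratedDeriv_le_of_forall_mem_sphere_norm_le` applies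
with `n = 2`. [cite: Balaban1985Averaging, (21) p.21, (42) p.23] -/
theorem norm_iteratedDeriv_two_mlog_ray_ratio_le (L : ℕ) (hL : 1 ≤ L) (s : ℂ) {ρ : ℝ} (hρ : 0 < ρ)
    (h : (2 * d * L + 2 * L) * (ρ * a + ‖s‖ * b) ≤ 1 / 20) (q : Site d) (κ : Fin d) :
    ‖iteratedDeriv 2 (fun u : ℂ =>
        mlog (((bavg L (expCfg (u • A) * expCfg (s • B)) q κ * (bavg L (expCfg (s • B)) q κ)⁻¹ : 𝔸ˣ) : 𝔸))) 0‖
      ≤ 2 / ρ ^ 2 := by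
  have hdisc : ∀ t : ℂ, ‖t‖ ≤ ρ → (2 * d * L + 2 * L) * (‖t‖ * a + ‖s‖ * b) ≤ 1 / 20 := by
    intro t ht
    have : (2 * d * L + 2 * L) * (‖t‖ * a + ‖s‖ * b) ≤ (2 * d * L + 2 * L) * (ρ * a + ‖s‖ * b) := by
      gcongr
    linarith
  have hdiffOn : DifferentiableOn ℂ (fun u : ℂ =>
      mlog (((bavg L (expCfg (u • A) * expCfg (s • B)) q κ * (bavg L (expCfg (s • B)) q κ)⁻¹ : 𝔸ˣ) : 𝔸)))
      (closedBall (0 : ℂ) ρ) := fun t ht =>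
    (differentiableAt_mlog_ray_ratio s ha hb hann hbnn L hL t (hdisc t (by simpa using ht)) q κ).differentiableWithinAt
  have hC : ∀ z ∈ sphere (0 : ℂ) ρ, ‖mlog (((bavg L (expCfg (z • A) * expCfg (s • B)) q κ
      * (bavg L (expCfg (s • B)) q κ)⁻¹ : 𝔸ˣ) : 𝔸))‖ ≤ 1 := by
    intro z hz
    have hz' : ‖z‖ ≤ ρ := by simpa using (mem_sphere_iff_norm.1 hz).le
    have hR := norm_ray_ratio_sub_one_le_half ha hb hann hbnn L hL s z (hdisc z hz') q κ
    exact (norm_mlog_le_two_mul hR).trans (by linarith)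
  have hmain := Complex.norm_iteratedDeriv_le_of_forall_mem_sphere_norm_le 2 hρ (hdiffOn.diffContOnCl_ball subset_rfl) hC
  simpa [Nat.factorial] using hmain

/-- **AT EVERY SMALL CURVED BACKGROUND, THE QUADRATIC TERM IS SECOND ORDER IN THE SLOT WITH A UNIFORM CONSTANT**: for `L ≥ 1`,
`ℓ = 2dL + 2L`, a background generator `B` with `ℓ·b ≤ 1∕40` and a slot field `A` with `0 < a`:
`‖d²/dt²|₀ log( Ū_c(e^{tA}·e^{B}) · Ū_c(e^{B})⁻¹ )‖ ≤ 3200·ℓ²·a²` (the previous theorem with `s = 1`, `ρ = 1∕(40ℓa)`).  The flat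
case `B = 0` is files 8∕12 (then the left side is `≤ ((2d+3)L)²·m`, and `0` for one-parameter slots); the constant here is uniform in
the background — the `M = C·a²` input of R61-PLAN's Lipschitz step. [cite: Balaban1985Averaging, (42) p.23, (121) p.36] -/
theorem norm_iteratedDeriv_two_mlog_background_ratio_le (L : ℕ) (hL : 1 ≤ L) (ha0 : 0 < a)
    (hB : (2 * d * L + 2 * L) * b ≤ 1 / 40) (q : Site d) (κ : Fin d) :
    ‖iteratedDeriv 2 (fun u : ℂ =>
        mlog (((bavg L (expCfg (u • A) * expCfg B) q κ * (bavg L (expCfg B) q κ)⁻¹ : 𝔸ˣ) : 𝔸))) 0‖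
      ≤ 3200 * (2 * d * L + 2 * L) ^ 2 * a ^ 2 := by
  have hℓ : (0 : ℝ) < 2 * d * L + 2 * L := by
    have hL1 : (1 : ℝ) ≤ L := by exact_mod_cast hL
    have : (0 : ℝ) ≤ 2 * d * L := by positivity
    linarith
  set ρ : ℝ := 1 / (40 * (2 * d * L + 2 * L) * a) with hρdef
  have hρ : 0 < ρ := by rw [hρdef]; positivity
  have hcond : (2 * d * L + 2 * L) * (ρ * a + ‖(1 : ℂ)‖ * b) ≤ 1 / 20 := by
    rw [norm_one, one_mul, mul_add]
    have e1 : (2 * d * L + 2 * L) * (ρ * a) = 1 / 40 := by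
      rw [hρdef]; field_simp
    rw [e1]; linarith
  have hmain := norm_iteratedDeriv_two_mlog_ray_ratio_le ha hb hann hbnn L hL 1 hρ hcond q κ
  simp only [one_smul] at hmain
  have e2 : 2 / ρ ^ 2 = 3200 * (2 * d * L + 2 * L) ^ 2 * a ^ 2 := by
    rw [hρdef]; field_simp; ring
  rw [e2] at hmain
  exact hmain

end Cauchy

end Summit.QuantumFields.BalabanUV.T4Continuum.NE1p.B7AveragingCommutator

end
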